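import Literature.Computability.QuantumComplexity.CoreDescAbstract
import Literature.Computability.QuantumComplexity.CoreDescLayoutFP
import Literature.Computability.QuantumComplexity.HidingProgramMachine
import Literature.Computability.QuantumComplexity.TermCodeFP
import HarnessLib

/-!
# The abstract AJL block in polynomial time

Topic `Literature/Computability/QuantumComplexity`; fourth step of the uniformity half of the
discharge of `ajl_jonesApproxProblem_mem_PromiseBQP` (AJL Thm. 1.2; Arora–Barak §6.2). The abstract
gate list of one copy of the AJL block (`BP.copyA`, `CoreDescAbstract.lean`: Hadamard test around the
word circuit; slots; letters; OAA words of Hadamard sandwiches around compiled flag programs and the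
kit reflection) is computed in polynomial time from the block parameters `(n, r, k, R, F, T)` in unary
(`bpE`), in the typed `FP` algebra `CodeFP`: the generic constructors (`agates_fp`, `progA_fp`,
`phaseKickA_fp`, `sandwichA_fp`, `reflectA_fp`, `invA_fp`, `oaaWordA_fp`, `hadTestA_fp`), the
derived sizes and wires of a block (`BP.…_fp`), the abstract layout as an instance of `LayoutFP`
(`layA_layoutFP`, whence `gopsA_fp` by `compile_codeFP`), and the words, letters, slots, the word and
the copy (`rotWordC_fp`, …, **`copyA_fp`**).

## References

* D. Aharonov, V. Jones, Z. Landau, Algorithmica 55 (2009), Thm. 1.2 and §3.3 [AharonovJonesLandau2009].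
* S. Arora, B. Barak, *Computational Complexity: A Modern Approach*, CUP 2009, §1.3 and §6.2 [AroraBarak2009].
-/

noncomputable section

namespace Literature.Computability.QuantumComplexity

open _root_.Computability Cryptography Complexity Complexity.CodeFP SLP RevDesc BlockKit

namespace AJLCore

/-! ### Abstract gates on codes -/

/-- The tuple of an abstract gate: symbol code and wires. [folklore] -/
def agTuple (a : AG) : ℕ × List ℕ := (symCode a.sym, a.wires)

/-- The working code of an abstract gate (symbol code in binary, wires as a raw list). [folklore] -/
def agE0 : AG → List Bool := fun a => ctE (agTuple a)

section AGCodes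

variable {α : Type} {eα : α → List Bool}

/-- An abstract gate from its tuple computed on codes. [folklore] -/
theorem ag_of_tuple {g : α → AG} {t : α → ℕ × List ℕ} (ht : CodeFP eα ctE t) (h : ∀ a, agTuple (g a) = t a) : CodeFP eα agE0 g :=
  ht.recodeOut fun a => by rw [agE0]; exact congrArg ctE (h a).symm

/-- `H` on codes. [folklore] -/
theorem ag_H {w : α → ℕ} (hw : CodeFP eα natE w) : CodeFP eα agE0 (fun a => (⟨.H, [w a]⟩ : AG)) :=
  ag_of_tuple ((const eα 0).pair ((rawSingleton natE).comp hw)) fun _ => rfl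

/-- `S` on codes. [folklore] -/
theorem ag_S {w : α → ℕ} (hw : CodeFP eα natE w) : CodeFP eα agE0 (fun a => (⟨.S, [w a]⟩ : AG)) :=
  ag_of_tuple ((const eα 1).pair ((rawSingleton natE).comp hw)) fun _ => rfl

/-- `CNOT` on codes. [folklore] -/
theorem ag_CX {c t : α → ℕ} (hc : CodeFP eα natE c) (ht : CodeFP eα natE t) : CodeFP eα agE0 (fun a => (⟨.CNOT, [c a, t a]⟩ : AG)) :=
  ag_of_tuple ((const eα 3).pair (natList2 hc ht)) fun _ => rfl

/-- A one-gate list. [folklore] -/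
theorem agList1 {o : α → AG} (ho : CodeFP eα agE0 o) : CodeFP eα (rawE agE0) (fun a => [o a]) := (rawSingleton agE0).comp ho

/-- Prepending a gate. [folklore] -/
theorem agCons {o : α → AG} {l : α → List AG} (ho : CodeFP eα agE0 o) (hl : CodeFP eα (rawE agE0) l) :
    CodeFP eα (rawE agE0) (fun a => o a :: l a) := ((rawCons agE0).comp (ho.pair hl) :)

/-- Concatenating gate lists. [folklore] -/
theorem agAppend {l l' : α → List AG} (hl : CodeFP eα (rawE agE0) l) (hl' : CodeFP eα (rawE agE0) l') :
    CodeFP eα (rawE agE0) (fun a => l a ++ l' a) := ((rawAppend agE0).comp (hl.pair hl') :)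

end AGCodes

/-! ### Generic list plumbing -/

/-- `reverse` as a left fold of `cons`. [folklore] -/
theorem foldl_cons_eq_reverse {α : Type} (l acc : List α) : l.foldl (fun b a => a :: b) acc = l.reverse ++ acc := by
  induction l generalizing acc with
  | nil => rfl
  | cons a l ih => rw [List.foldl_cons, ih, List.reverse_cons, List.append_assoc]; rfl

/-- **Reversal of raw lists.** [folklore] -/
theorem rawReverse {α : Type} (eα : α → List Bool) : CodeFP (rawE eα) (rawE eα) List.reverse := by
  have h := foldl₀ (eα := eα) (eβ := rawE eα) (step := fun (a : α) (b : List α) => a :: b) (b₀ := [])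
    ((rawCons eα).comp ((fst _ _).pair (snd _ _))) Polynomial.X (fun l₁ l₂ => by
      rw [foldl_cons_eq_reverse, List.append_nil, Polynomial.eval_X, length_rawE, length_rawE, List.map_reverse, List.sum_reverse]
      exact List.Sublist.sum_le_sum ((List.sublist_append_left l₁ l₂).map _) fun _ _ => Nat.zero_le _)
  exact h.congr fun l => by rw [foldl_cons_eq_reverse, List.append_nil]

/-- The last element with a default is indexing at `length - 1`. [folklore] -/
theorem getLastD_eq_getD {α : Type} (d : α) : ∀ l : List α, l.getLastD d = l.getD (l.length - 1) d
  | [] => rfl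
  | [a] => rfl
  | a :: b :: l => by
    rw [List.getLastD_cons_cons', getLastD_eq_getD d (b :: l)]
    simp
where
  /-- auxiliary: `getLastD` skips the head of a list with at least two items. [folklore] -/
  List.getLastD_cons_cons' {α : Type} (d a b : α) (l : List α) : (a :: b :: l).getLastD d = (b :: l).getLastD d := by
    simp [List.getLastD]

/-- **The last element of a raw list of numerals** (default `0`). [folklore] -/
theorem rawGetLastD : CodeFP (rawE natE) natE (fun l => l.getLastD 0) :=
  ((rawGetD natE (d := 0) natE_zero).comp ((CodeFP.id _).pair (natSub.comp ((natLength natE).pair (const _ 1))))).congr fun l => by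
    rw [getLastD_eq_getD]; rfl

/-! ### Compiled words on codes -/

/-- `agates` on gate tuples. [cite: NielsenChuang2010, §4.3 Fig. 4.9] -/
def agatesT (u : ℕ × List ℕ) : List AG :=
  if u.1 = 0 then [⟨.H, [u.2.getD 0 0]⟩, ⟨.S, [u.2.getD 0 0]⟩, ⟨.S, [u.2.getD 0 0]⟩, ⟨.H, [u.2.getD 0 0]⟩]
  else if u.1 = 1 then [⟨.CNOT, [u.2.getD 0 0, u.2.getD 1 0]⟩]
  else
    [⟨.H, [u.2.getD 2 0]⟩, ⟨.T, [u.2.getD 0 0]⟩, ⟨.T, [u.2.getD 1 0]⟩, ⟨.T, [u.2.getD 2 0]⟩, ⟨.CNOT, [u.2.getD 0 0, u.2.getD 1 0]⟩,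
      ⟨.S, [u.2.getD 1 0]⟩, ⟨.S, [u.2.getD 1 0]⟩, ⟨.S, [u.2.getD 1 0]⟩, ⟨.T, [u.2.getD 1 0]⟩, ⟨.CNOT, [u.2.getD 1 0, u.2.getD 2 0]⟩,
      ⟨.T, [u.2.getD 2 0]⟩, ⟨.CNOT, [u.2.getD 0 0, u.2.getD 2 0]⟩, ⟨.S, [u.2.getD 2 0]⟩, ⟨.S, [u.2.getD 2 0]⟩, ⟨.S, [u.2.getD 2 0]⟩,
      ⟨.T, [u.2.getD 2 0]⟩, ⟨.CNOT, [u.2.getD 1 0, u.2.getD 2 0]⟩, ⟨.S, [u.2.getD 2 0]⟩, ⟨.S, [u.2.getD 2 0]⟩, ⟨.S, [u.2.getD 2 0]⟩,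
      ⟨.T, [u.2.getD 2 0]⟩, ⟨.CNOT, [u.2.getD 0 0, u.2.getD 2 0]⟩, ⟨.CNOT, [u.2.getD 0 0, u.2.getD 1 0]⟩, ⟨.H, [u.2.getD 2 0]⟩]

/-- `agates` is `agatesT` of the tuple. [folklore] -/
theorem agates_eq_agatesT (op : ClOp ℕ) : agates op = agatesT (clopTuple op) := by cases op <;> rfl

/-- **`agates` on codes.** [folklore] -/
theorem agates_fp : CodeFP clopE (rawE agE0) agates := by
  have hw : ∀ i : ℕ, CodeFP ctE natE (fun u => u.2.getD i 0) := fun i => (rawGetD natE (d := 0) natE_zero).comp ((snd _ _).pair (const _ i))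
  have hT : ∀ i : ℕ, CodeFP ctE agE0 (fun u => (⟨.T, [u.2.getD i 0]⟩ : AG)) := fun i => ag_of_tuple ((const ctE 2).pair ((rawSingleton natE).comp (hw i))) fun _ => rfl
  have h0 : CodeFP ctE (rawE agE0) (fun u => [⟨.H, [u.2.getD 0 0]⟩, ⟨.S, [u.2.getD 0 0]⟩, ⟨.S, [u.2.getD 0 0]⟩, ⟨.H, [u.2.getD 0 0]⟩]) :=
    agCons (ag_H (hw 0)) (agCons (ag_S (hw 0)) (agCons (ag_S (hw 0)) (agList1 (ag_H (hw 0)))))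
  have h1 : CodeFP ctE (rawE agE0) (fun u => [⟨.CNOT, [u.2.getD 0 0, u.2.getD 1 0]⟩]) := agList1 (ag_CX (hw 0) (hw 1))
  have h2 : CodeFP ctE (rawE agE0) (fun u =>
      [⟨.H, [u.2.getD 2 0]⟩, ⟨.T, [u.2.getD 0 0]⟩, ⟨.T, [u.2.getD 1 0]⟩, ⟨.T, [u.2.getD 2 0]⟩, ⟨.CNOT, [u.2.getD 0 0, u.2.getD 1 0]⟩,
      ⟨.S, [u.2.getD 1 0]⟩, ⟨.S, [u.2.getD 1 0]⟩, ⟨.S, [u.2.getD 1 0]⟩, ⟨.T, [u.2.getD 1 0]⟩, ⟨.CNOT, [u.2.getD 1 0, u.2.getD 2 0]⟩,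
      ⟨.T, [u.2.getD 2 0]⟩, ⟨.CNOT, [u.2.getD 0 0, u.2.getD 2 0]⟩, ⟨.S, [u.2.getD 2 0]⟩, ⟨.S, [u.2.getD 2 0]⟩, ⟨.S, [u.2.getD 2 0]⟩,
      ⟨.T, [u.2.getD 2 0]⟩, ⟨.CNOT, [u.2.getD 1 0, u.2.getD 2 0]⟩, ⟨.S, [u.2.getD 2 0]⟩, ⟨.S, [u.2.getD 2 0]⟩, ⟨.S, [u.2.getD 2 0]⟩,
      ⟨.T, [u.2.getD 2 0]⟩, ⟨.CNOT, [u.2.getD 0 0, u.2.getD 2 0]⟩, ⟨.CNOT, [u.2.getD 0 0, u.2.getD 1 0]⟩, ⟨.H, [u.2.getD 2 0]⟩]) :=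
    agCons (ag_H (hw 2)) (agCons (hT 0) (agCons (hT 1) (agCons (hT 2) (agCons (ag_CX (hw 0) (hw 1))
      (agCons (ag_S (hw 1)) (agCons (ag_S (hw 1)) (agCons (ag_S (hw 1)) (agCons (hT 1) (agCons (ag_CX (hw 1) (hw 2))
        (agCons (hT 2) (agCons (ag_CX (hw 0) (hw 2)) (agCons (ag_S (hw 2)) (agCons (ag_S (hw 2)) (agCons (ag_S (hw 2))
          (agCons (hT 2) (agCons (ag_CX (hw 1) (hw 2)) (agCons (ag_S (hw 2)) (agCons (ag_S (hw 2)) (agCons (ag_S (hw 2))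
            (agCons (hT 2) (agCons (ag_CX (hw 0) (hw 2)) (agCons (ag_CX (hw 0) (hw 1)) (agList1 (ag_H (hw 2)))))))))))))))))))))))))
  have htag : ∀ c : ℕ, CodeFP ctE bitE (fun u => decide (u.1 = c)) := fun c => natEq.comp ((fst _ _).pair (const _ c))
  have hT' : CodeFP ctE (rawE agE0) agatesT := iteProp (htag 0) h0 (iteProp (htag 1) h1 h2)
  exact ((hT'.comp (transparent (eα := clopE) (eβ := ctE) (g := clopTuple) fun _ => rfl)).congr fun op => (agates_eq_agatesT op).symm :)

/-- **Compiled programs on codes.** [folklore] -/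
theorem progA_fp : CodeFP (rawE clopE) (rawE agE0) progA := ((flatten agE0).comp (map₀ agates_fp)).congr fun _ => rfl

/-! ### The generic constructors on codes -/

/-- `H` layers. [folklore] -/
theorem hLayerA_fp : CodeFP (rawE natE) (rawE agE0) hLayerA := (map₀ (ag_H (CodeFP.id natE))).congr fun _ => rfl

/-- `S` layers. [folklore] -/
theorem sLayerA_fp : CodeFP (rawE natE) (rawE agE0) (fun Fs => Fs.map fun f => (⟨.S, [f]⟩ : AG)) := map₀ (ag_S (CodeFP.id natE))

/-- `Z` layers. [folklore] -/
theorem zLayerA_fp : CodeFP (rawE natE) (rawE agE0) (fun Fz => Fz.flatMap fun f => [(⟨.S, [f]⟩ : AG), ⟨.S, [f]⟩]) :=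
  ((flatten agE0).comp (map₀ (agCons (ag_S (CodeFP.id natE)) (agList1 (ag_S (CodeFP.id natE)))))).congr fun _ => rfl

/-- **Phase kicks on codes**: `(ops, Fs, Fz) ↦ phaseKickA ops Fs Fz`. [folklore] -/
theorem phaseKickA_fp : CodeFP (pairE (rawE clopE) (pairE (rawE natE) (rawE natE))) (rawE agE0) (fun t => phaseKickA t.1 t.2.1 t.2.2) :=
  agAppend (agAppend (agAppend (progA_fp.comp (fst _ _)) (sLayerA_fp.comp (snd _ _).fst')) (zLayerA_fp.comp (snd _ _).snd'))
    (progA_fp.comp ((rawReverse clopE).comp (fst _ _)))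

/-- **Sandwiches on codes**: `(ws, c, t, ops, Fs, Fz) ↦ sandwichA ws c t ops Fs Fz`. [folklore] -/
theorem sandwichA_fp : CodeFP (pairE (rawE natE) (pairE natE (pairE natE (pairE (rawE clopE) (pairE (rawE natE) (rawE natE)))))) (rawE agE0)
    (fun t => sandwichA t.1 t.2.1 t.2.2.1 t.2.2.2.1 t.2.2.2.2.1 t.2.2.2.2.2) :=
  agAppend (agAppend (agAppend (hLayerA_fp.comp (fst _ _)) (phaseKickA_fp.comp (snd _ _).snd'.snd')) (agList1 (ag_CX (snd _ _).fst' (snd _ _).snd'.fst')))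
    ((rawReverse agE0).comp (hLayerA_fp.comp (fst _ _)))

/-- **Diagonal sandwiches on codes**: `(ws, ops, Fs, Fz) ↦ phaseSandwichA ws ops Fs Fz`. [folklore] -/
theorem phaseSandwichA_fp : CodeFP (pairE (rawE natE) (pairE (rawE clopE) (pairE (rawE natE) (rawE natE)))) (rawE agE0)
    (fun t => phaseSandwichA t.1 t.2.1 t.2.2.1 t.2.2.2) :=
  agAppend (agAppend (hLayerA_fp.comp (fst _ _)) (phaseKickA_fp.comp (snd _ _))) ((rawReverse agE0).comp (hLayerA_fp.comp (fst _ _)))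

/-- `clChain` as a `zipWith` against the previous targets. [folklore] -/
theorem clChain_eq_zipWith {ι : Type} : ∀ (a₀ : ι) (ls as : List ι),
    clChain a₀ ls as = List.zipWith (fun pl a => ClOp.toffoli pl.1 pl.2 a) ((a₀ :: as).zip ls) as
  | a₀, [], as => by simp
  | a₀, l :: ls, [] => by simp [clChain]
  | a₀, l :: ls, a :: as => by rw [clChain, clChain_eq_zipWith a ls as, List.zip_cons_cons, List.zipWith_cons_cons]

/-- **Reflection programs on codes**: `(a₀, ls, as) ↦ reflectProgA a₀ ls as`. [folklore] -/
theorem reflectProgA_fp : CodeFP (pairE natE (pairE (rawE natE) (rawE natE))) (rawE clopE) (fun t => reflectProgA t.1 t.2.1 t.2.2) := by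
  have hnots : CodeFP (pairE natE (pairE (rawE natE) (rawE natE))) (rawE clopE) (fun t => (t.1 :: t.2.1).map ClOp.not) :=
    (map₀ (clop_not (CodeFP.id natE))).comp ((rawCons natE).comp ((fst _ _).pair (snd _ _).fst'))
  have hzip : CodeFP (pairE natE (pairE (rawE natE) (rawE natE))) (rawE (pairE natE natE)) (fun t => (t.1 :: t.2.2).zip t.2.1) :=
    ((zipWith (σ := Unit) (eσ := unitE) (g := fun q : Unit × ℕ × ℕ => (q.2.1, q.2.2)) ((snd _ _).fst'.pair (snd _ _).snd')).comp
      ((const _ ()).pair (((rawCons natE).comp ((fst _ _).pair (snd _ _).snd')).pair (snd _ _).fst'))).congr fun _ => rfl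
  have hch : CodeFP (pairE natE (pairE (rawE natE) (rawE natE))) (rawE clopE)
      (fun t => List.zipWith (fun pl a => ClOp.toffoli pl.1 pl.2 a) ((t.1 :: t.2.2).zip t.2.1) t.2.2) :=
    ((zipWith (σ := Unit) (eσ := unitE) (g := fun q : Unit × (ℕ × ℕ) × ℕ => ClOp.toffoli q.2.1.1 q.2.1.2 q.2.2)
      (clop_toffoli (snd _ _).fst'.fst' (snd _ _).fst'.snd' (snd _ _).snd')).comp ((const _ ()).pair (hzip.pair (snd _ _).snd'))).congr fun _ => rfl
  exact (clopAppend hnots hch).congr fun t => by rw [reflectProgA, clChain_eq_zipWith]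

/-- **Reflections on codes**: `(a₀, ls, as) ↦ reflectA a₀ ls as`. [folklore] -/
theorem reflectA_fp : CodeFP (pairE natE (pairE (rawE natE) (rawE natE))) (rawE agE0) (fun t => reflectA t.1 t.2.1 t.2.2) :=
  (phaseKickA_fp.comp (reflectProgA_fp.pair ((const _ ([] : List ℕ)).pair ((rawSingleton natE).comp (rawGetLastD.comp (snd _ _).snd'))))).congr fun _ => rfl

/-- The inverse word of one abstract gate. [folklore] -/
theorem invWordA_fp : CodeFP agE0 (rawE agE0) (fun a => List.replicate (invReps a.sym) a) := by
  have hc : ∀ c : ℕ, CodeFP agE0 bitE (fun a => decide (symCode a.sym = c)) := fun c =>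
    natEq.comp (((fst _ _).comp (transparent (eα := agE0) (eβ := ctE) (g := agTuple) fun _ => rfl)).pair (const _ c))
  have h : CodeFP agE0 (rawE agE0) (fun a => if symCode a.sym = 1 then [a, a, a] else if symCode a.sym = 2 then [a, a, a, a, a, a, a] else [a]) :=
    iteProp (hc 1) (agCons (CodeFP.id _) (agCons (CodeFP.id _) (agList1 (CodeFP.id _))))
      (iteProp (hc 2) (agCons (CodeFP.id _) (agCons (CodeFP.id _) (agCons (CodeFP.id _) (agCons (CodeFP.id _) (agCons (CodeFP.id _) (agCons (CodeFP.id _) (agList1 (CodeFP.id _))))))))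
        (agList1 (CodeFP.id _)))
  exact h.congr fun a => by obtain ⟨s, ws⟩ := a; cases s <;> rfl

/-- **Inverse words on codes.** [folklore] -/
theorem invA_fp : CodeFP (rawE agE0) (rawE agE0) invA := ((flatten agE0).comp ((map₀ invWordA_fp).comp (rawReverse agE0))).congr fun _ => rfl

/-- **OAA words on codes.** [folklore] -/
theorem oaaWordA_fp : CodeFP (pairE (rawE agE0) (rawE agE0)) (rawE agE0) (fun t => oaaWordA t.1 t.2) :=
  agAppend (agAppend (agAppend (agAppend (fst _ _) (snd _ _)) (invA_fp.comp (fst _ _))) (snd _ _)) (fst _ _)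

/-- **Hadamard tests on codes**: `(q, W, im) ↦ hadTestA q W im`. [folklore] -/
theorem hadTestA_fp : CodeFP (pairE natE (pairE (rawE agE0) bitE)) (rawE agE0) (fun t => hadTestA t.1 t.2.1 t.2.2) :=
  agAppend (agAppend (agAppend (agList1 (ag_H (fst _ _))) (snd _ _).fst')
    (((snd _ _).snd'.ite (agCons (ag_S (fst _ _)) (agCons (ag_S (fst _ _)) (agList1 (ag_S (fst _ _))))) (const _ ([] : List AG))).congr fun _ => rfl))
    (agList1 (ag_H (fst _ _)))

/-! ### The block parameters on codes -/

/-- **The code of the block parameters**: `(1ⁿ, 1ʳ, 1ᵏ, 1ᴿ, 1^F, 1ᵀ)`. [folklore] -/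
def bpE : BP → List Bool := fun p => pairE unE (pairE unE (pairE unE (pairE unE (pairE unE unE)))) (p.n, p.r, p.k, p.R, p.F, p.T)

namespace BP

/-- The six fields, in unary. [folklore] -/
theorem fields_u : CodeFP bpE unE BP.n ∧ CodeFP bpE unE BP.r ∧ CodeFP bpE unE BP.k ∧ CodeFP bpE unE BP.R ∧ CodeFP bpE unE BP.F ∧ CodeFP bpE unE BP.T := by
  have h : CodeFP bpE (pairE unE (pairE unE (pairE unE (pairE unE (pairE unE unE))))) (fun p => (p.n, p.r, p.k, p.R, p.F, p.T)) := transparent fun _ => rfl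
  exact ⟨h.fst', h.snd'.fst', h.snd'.snd'.fst', h.snd'.snd'.snd'.fst', h.snd'.snd'.snd'.snd'.fst', h.snd'.snd'.snd'.snd'.snd'⟩

/-- From unary to binary. [folklore] -/
theorem toNat {α : Type} {eα : α → List Bool} {f : α → ℕ} (h : CodeFP eα unE f) : CodeFP eα natE f := (natOfUn.comp h).congr fun _ => rfl

/-- Unary sums. [folklore] -/
theorem uadd {α : Type} {eα : α → List Bool} {f g : α → ℕ} (hf : CodeFP eα unE f) (hg : CodeFP eα unE g) : CodeFP eα unE (fun a => f a + g a) :=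
  (unAdd.comp (hf.pair hg) :)

/-- Unary products. [folklore] -/
theorem umul {α : Type} {eα : α → List Bool} {f g : α → ℕ} (hf : CodeFP eα unE f) (hg : CodeFP eα unE g) : CodeFP eα unE (fun a => f a * g a) :=
  (unMul_codeFP.comp (hf.pair hg) :)

/-- Unary constants. [folklore] -/
theorem uconst {α : Type} (eα : α → List Bool) (c : ℕ) : CodeFP eα unE (fun _ => c) := const eα c

/-- `A = 2(n-1)`, in unary. [folklore] -/
theorem A_u : CodeFP bpE unE BP.A := by
  obtain ⟨hn, -, -, -, -, -⟩ := fields_u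
  have h1 : CodeFP bpE unE (fun p => p.n - 1) := (unOfNatMin.comp (hn.pair (natSub.comp ((toNat hn).pair (const _ 1))))).congr fun p => by
    show min (p.n - 1) p.n = p.n - 1; omega
  exact (uadd h1 h1).congr fun p => by show p.n - 1 + (p.n - 1) = 2 * (p.n - 1); omega

/-- `Wd = 4k + 16`, in unary. [folklore] -/
theorem Wd_u : CodeFP bpE unE BP.Wd := ((affUn 4 16).comp fields_u.2.2.1).congr fun _ => rfl

/-- `scr = 3 Wd + 1`, in unary. [folklore] -/
theorem scr_u : CodeFP bpE unE BP.scr := ((affUn 12 49).comp fields_u.2.2.1).congr fun p => by show 12 * p.k + 49 = 3 * (4 * p.k + 16) + 1; ring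

/-- `rs = R·Wd + F + T·scr`, in unary. [folklore] -/
theorem rs_u : CodeFP bpE unE BP.rs := by
  obtain ⟨-, -, -, hR, hF, hT⟩ := fields_u
  exact (uadd (uadd (umul hR Wd_u) hF) (umul hT scr_u)).congr fun _ => rfl

/-- `dOff = 1 + 2(n+1) + r·A`, in unary. [folklore] -/
theorem dOff_u : CodeFP bpE unE BP.dOff := by
  obtain ⟨hn, hr, -, -, -, -⟩ := fields_u
  exact (uadd (uadd (uconst _ 1) ((affUn 2 2).comp hn)) (umul hr A_u)).congr fun p => by show 1 + (2 * p.n + 2) + p.r * p.A = 1 + 2 * (p.n + 1) + p.r * p.A; ring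

/-- `rbv`, in unary. [folklore] -/
theorem rbv_u : CodeFP bpE unE BP.rbv := by
  obtain ⟨-, -, hk, -, -, -⟩ := fields_u
  exact (uadd (uadd (uadd dOff_u (uconst _ 2)) hk) (uadd hk rs_u)).congr fun _ => rfl

/-- The block size `b`, in unary. [folklore] -/
theorem b_u : CodeFP bpE unE BP.b := (uadd rbv_u rs_u).congr fun _ => rfl

/-- The flag base, in unary. [folklore] -/
theorem fb_u : CodeFP bpE unE BP.fb := (uadd rbv_u (umul fields_u.2.2.2.1 Wd_u)).congr fun _ => rfl

/-- The scratch base, in unary. [folklore] -/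
theorem sb_u : CodeFP bpE unE BP.sb := (uadd fb_u fields_u.2.2.2.2.1).congr fun _ => rfl

section Ctx

variable {α : Type} {eα : α → List Bool} {P : α → BP} (hP : CodeFP eα bpE P)
include hP

/-- Wires `v % b` in a context. [folklore] -/
theorem w_fp {v : α → ℕ} (hv : CodeFP eα natE v) : CodeFP eα natE (fun a => (P a).w (v a)) := (natMod.comp (hv.pair (toNat (b_u.comp hP))) :)

/-- The local register wires `e i j` in a context. [folklore] -/
theorem e_fp {i j : α → ℕ} (hi : CodeFP eα natE i) (hj : CodeFP eα natE j) : CodeFP eα natE (fun a => (P a).e (i a) (j a)) :=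
  w_fp hP ((natAdd.comp ((const _ 1).pair (natAdd.comp ((natMul.comp ((const _ 2).pair hi)).pair hj)))) :)

/-- The table wires `tw s x` in a context. [folklore] -/
theorem tw_fp {s x : α → ℕ} (hs : CodeFP eα natE s) (hx : CodeFP eα natE x) : CodeFP eα natE (fun a => (P a).tw (s a) (x a)) := by
  have h : CodeFP eα natE (fun a => 1 + (2 * (P a).n + 2) + s a * (P a).A + x a) :=
    (natAdd.comp ((natAdd.comp ((natAdd.comp ((const _ 1).pair (toNat ((affUn 2 2).comp (fields_u.1.comp hP))))).pair (natMul.comp (hs.pair (toNat (A_u.comp hP)))))).pair hx) :)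
  exact w_fp hP (h.congr fun a => by show 1 + (2 * (P a).n + 2) + s a * (P a).A + x a = 1 + 2 * ((P a).n + 1) + s a * (P a).A + x a; ring)

/-- The flag wire of a compiler output in a context. [folklore] -/
theorem gflagA_fp {c : α → List Instr × ℕ × ℕ × ℕ} (hc : CodeFP eα outBE c) : CodeFP eα natE (fun a => (P a).gflagA (c a)) :=
  w_fp hP ((natAdd.comp ((toNat (fb_u.comp hP)).pair (toNat hc.snd'.fst'))) :)

end Ctx

/-- The selector wire. [folklore] -/
theorem cr_n : CodeFP bpE natE BP.cr := w_fp (CodeFP.id _) (toNat (uadd dOff_u (uconst _ 1)))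
/-- The dummy wire. [folklore] -/
theorem d0_n : CodeFP bpE natE BP.d0 := w_fp (CodeFP.id _) (toNat dOff_u)
/-- The test qubit. [folklore] -/
theorem q_n : CodeFP bpE natE BP.q := w_fp (CodeFP.id _) (const _ 0)

/-- The averaging wires. [folklore] -/
theorem as_fp : CodeFP bpE (rawE natE) BP.as :=
  ((map (σ := BP) (α := ℕ) (g := fun t => t.1.w (t.1.dOff + 2 + t.2))
      (w_fp (fst _ _) (natAdd.comp ((natAdd.comp ((toNat (dOff_u.comp (fst _ _))).pair (const _ 2))).pair (snd _ _))))).comp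
    ((CodeFP.id _).pair (urange.comp fields_u.2.2.1))).congr fun _ => rfl

/-- The helper wires. [folklore] -/
theorem hs_fp : CodeFP bpE (rawE natE) BP.hs :=
  ((map (σ := BP) (α := ℕ) (g := fun t => t.1.w (t.1.dOff + 2 + t.1.k + t.2))
      (w_fp (fst _ _) (natAdd.comp ((natAdd.comp ((natAdd.comp ((toNat (dOff_u.comp (fst _ _))).pair (const _ 2))).pair (toNat (fields_u.2.2.1.comp (fst _ _))))).pair (snd _ _))))).comp
    ((CodeFP.id _).pair (urange.comp (uadd fields_u.2.2.1 rs_u)))).congr fun _ => rfl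

/-- An offset range `[base + i | i < len]` from a unary length. [folklore] -/
theorem offRange_fp {base len : BP → ℕ} (hb : CodeFP bpE natE base) (hl : CodeFP bpE unE len) :
    CodeFP bpE (rawE natE) (fun p => (List.range (len p)).map fun i => base p + i) :=
  ((map (σ := BP) (α := ℕ) (g := fun t => base t.1 + t.2) (natAdd.comp ((hb.comp (fst _ _)).pair (snd _ _)))).comp ((CodeFP.id _).pair (urange.comp hl))).congr fun _ => rfl

/-- The classical region. [folklore] -/
theorem region_fp : CodeFP bpE (rawE natE) BP.region := by
  have h3 : CodeFP bpE (rawE natE) (fun p => (List.range (p.R * p.Wd)).map (fun i => p.rbv + i) ++ (List.range p.F).map (fun i => p.fb + i) ++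
      (List.range (p.T * p.scr)).map (fun i => p.sb + i)) :=
    ((rawAppend natE).comp (((rawAppend natE).comp ((offRange_fp (toNat rbv_u) (umul fields_u.2.2.2.1 Wd_u)).pair (offRange_fp (toNat fb_u) fields_u.2.2.2.2.1))).pair
      (offRange_fp (toNat sb_u) (umul fields_u.2.2.2.2.2 scr_u))) :)
  exact ((map (σ := BP) (α := ℕ) (g := fun t => t.1.w t.2) (w_fp (fst _ _) (snd _ _))).comp ((CodeFP.id _).pair h3)).congr fun _ => rfl

/-- **The kit reflection on codes.** [folklore] -/
theorem GRA_fp : CodeFP bpE (rawE agE0) BP.GRA :=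
  (reflectA_fp.comp (cr_n.pair (((rawAppend natE).comp (as_fp.pair region_fp)).pair hs_fp))).congr fun _ => rfl

/-- **The abstract layouts are computed on codes.** [folklore] -/
theorem layA_layoutFP : LayoutFP bpE BP.layA BP.Wd where
  iw := by
    have hP : CodeFP (pairE (pairE bpE (rawE natE)) natE) bpE (fun t => t.1.1) := (fst _ _).fst'
    have hj : CodeFP (pairE (pairE bpE (rawE natE)) natE) natE (fun t => t.2) := snd _ _
    have hk : CodeFP (pairE (pairE bpE (rawE natE)) natE) natE (fun t => t.1.1.k) := toNat (fields_u.2.2.1.comp hP)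
    have h1 : CodeFP (pairE (pairE bpE (rawE natE)) natE) natE (fun t => t.1.1.w (t.1.1.dOff + 2 + t.2)) :=
      w_fp hP (natAdd.comp ((natAdd.comp ((toNat (dOff_u.comp hP)).pair (const _ 2))).pair hj))
    have h3 : CodeFP (pairE (pairE bpE (rawE natE)) natE) natE (fun t => t.1.2.getD (t.2 - (t.1.1.k + 1)) t.1.1.cr) :=
      ((rawGetOr natE).comp ((fst _ _).snd'.pair ((natSub.comp (hj.pair (natAdd.comp (hk.pair (const _ 1))))).pair (cr_n.comp hP))) :)
    exact (iteProp (natLt.comp (hj.pair hk)) h1 (iteProp (natEq.comp (hj.pair hk)) (cr_n.comp hP) h3)).congr fun _ => rfl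
  rb := (toNat (rbv_u.comp (fst _ _))).congr fun _ => rfl
  fb := (toNat (fb_u.comp (fst _ _))).congr fun _ => rfl
  sb := (toNat (sb_u.comp (fst _ _))).congr fun _ => rfl
  wd := Wd_u

/-- Re-indexing a gate tuple. [folklore] -/
theorem clopTuple_map (f : ℕ → ℕ) (op : ClOp ℕ) : clopTuple (op.map f) = ((clopTuple op).1, (clopTuple op).2.map f) := by cases op <;> rfl

/-- Reducing the wires of a gate modulo the block size, in a context. [folklore] -/
theorem clopMapW_fp : CodeFP (pairE bpE clopE) clopE (fun t => t.2.map t.1.w) := by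
  have hT : CodeFP (pairE bpE clopE) ctE (fun t => clopTuple t.2) := (transparent (eα := clopE) (eβ := ctE) (g := clopTuple) fun _ => rfl).comp (snd _ _)
  have hws : CodeFP (pairE bpE clopE) (rawE natE) (fun t => (clopTuple t.2).2.map t.1.w) :=
    ((map (σ := BP) (α := ℕ) (g := fun q => q.1.w q.2) (w_fp (fst _ _) (snd _ _))).comp ((fst _ _).pair hT.snd')).congr fun _ => rfl
  exact clop_of_tuple (hT.fst'.pair hws) fun t => clopTuple_map _ _

/-- **Compiled flag programs of a block on codes**: `(p, ins, c) ↦ p.gopsA ins c`. [cite: AroraBarak2009, §1.3 and §6.2] -/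
theorem gopsA_fp : CodeFP (pairE bpE (pairE (rawE natE) outBE)) (rawE clopE) (fun t => t.1.gopsA t.2.1 t.2.2) := by
  have hc : CodeFP (pairE bpE (pairE (rawE natE) outBE)) (rawE clopE) (fun t => SLP.compile (t.1.layA t.2.1) (Wd := t.1.Wd) t.2.2.1) :=
    (compile_codeFP layA_layoutFP).comp ((fst _ _).pair ((snd _ _).fst'.pair (snd _ _).snd'.fst'))
  exact ((map (σ := BP) (α := ClOp ℕ) (g := fun q => q.2.map q.1.w) clopMapW_fp).comp ((fst _ _).pair hc)).congr fun _ => rfl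

/-- The code of letter contexts `(p, i, s, x)`. [folklore] -/
abbrev lcE : BP × ℕ × ℕ × ℕ → List Bool := pairE bpE (pairE natE (pairE natE natE))

/-- The rotation inputs on codes. [folklore] -/
theorem insRotA_fp : CodeFP lcE (rawE natE) (fun t => t.1.insRotA t.2.1 t.2.2.1 t.2.2.2) := by
  have hP : CodeFP lcE bpE (fun t => t.1) := fst _ _
  have he : ∀ j : ℕ, CodeFP lcE natE (fun t => t.1.e t.2.1 j) := fun j => e_fp hP (snd _ _).fst' (const _ j)
  have htw : CodeFP lcE natE (fun t => t.1.tw t.2.2.1 t.2.2.2) := tw_fp hP (snd _ _).snd'.fst' (snd _ _).snd'.snd'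
  have hc : ∀ {f : BP × ℕ × ℕ × ℕ → ℕ} {l : BP × ℕ × ℕ × ℕ → List ℕ}, CodeFP lcE natE f → CodeFP lcE (rawE natE) l → CodeFP lcE (rawE natE) (fun t => f t :: l t) :=
    fun hf hl => ((rawCons natE).comp (hf.pair hl) :)
  exact hc (he 2) (hc (q_n.comp hP) (hc htw (hc (he 0) (hc (he 1) (hc (he 3) (hc (he 4) ((rawSingleton natE).comp (he 5))))))))

/-- The phase inputs on codes. [folklore] -/
theorem insPhaseA_fp : CodeFP lcE (rawE natE) (fun t => t.1.insPhaseA t.2.1 t.2.2.1 t.2.2.2) := by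
  have hP : CodeFP lcE bpE (fun t => t.1) := fst _ _
  have he : ∀ j : ℕ, CodeFP lcE natE (fun t => t.1.e t.2.1 j) := fun j => e_fp hP (snd _ _).fst' (const _ j)
  have htw : CodeFP lcE natE (fun t => t.1.tw t.2.2.1 t.2.2.2) := tw_fp hP (snd _ _).snd'.fst' (snd _ _).snd'.snd'
  have hc : ∀ {f : BP × ℕ × ℕ × ℕ → ℕ} {l : BP × ℕ × ℕ × ℕ → List ℕ}, CodeFP lcE natE f → CodeFP lcE (rawE natE) l → CodeFP lcE (rawE natE) (fun t => f t :: l t) :=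
    fun hf hl => ((rawCons natE).comp (hf.pair hl) :)
  exact hc (d0_n.comp hP) (hc (q_n.comp hP) (hc htw (hc (he 0) (hc (he 1) (hc (he 2) (hc (he 3) (hc (he 4) ((rawSingleton natE).comp (he 5)))))))))

/-- **Rotation words on codes**: `((p, i, s, x), c) ↦ p.rotWordC i s x c`. [folklore] -/
theorem rotWordC_fp : CodeFP (pairE lcE outBE) (rawE agE0) (fun t => t.1.1.rotWordC t.1.2.1 t.1.2.2.1 t.1.2.2.2 t.2) := by
  have hP : CodeFP (pairE lcE outBE) bpE (fun t => t.1.1) := (fst _ _).fst'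
  have hws : CodeFP (pairE lcE outBE) (rawE natE) (fun t => t.1.1.cr :: t.1.1.as) := ((rawCons natE).comp ((cr_n.comp hP).pair (as_fp.comp hP)) :)
  have hops : CodeFP (pairE lcE outBE) (rawE clopE) (fun t => t.1.1.gopsA (t.1.1.insRotA t.1.2.1 t.1.2.2.1 t.1.2.2.2) t.2) :=
    (gopsA_fp.comp (hP.pair ((insRotA_fp.comp (fst _ _)).pair (snd _ _))) :)
  have hsw : CodeFP (pairE lcE outBE) (rawE agE0) (fun t => sandwichA (t.1.1.cr :: t.1.1.as) t.1.1.cr (t.1.1.e t.1.2.1 2)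
      (t.1.1.gopsA (t.1.1.insRotA t.1.2.1 t.1.2.2.1 t.1.2.2.2) t.2) [] [t.1.1.gflagA t.2]) :=
    (sandwichA_fp.comp (hws.pair ((cr_n.comp hP).pair ((e_fp hP (fst _ _).snd'.fst' (const _ 2)).pair (hops.pair ((const _ ([] : List ℕ)).pair
      ((rawSingleton natE).comp (gflagA_fp hP (snd _ _)))))))) :)
  have hfin : CodeFP (pairE lcE outBE) (rawE agE0) (fun t => oaaWordA (sandwichA (t.1.1.cr :: t.1.1.as) t.1.1.cr (t.1.1.e t.1.2.1 2)
      (t.1.1.gopsA (t.1.1.insRotA t.1.2.1 t.1.2.2.1 t.1.2.2.2) t.2) [] [t.1.1.gflagA t.2]) t.1.1.GRA) := (oaaWordA_fp.comp (hsw.pair (GRA_fp.comp hP)) :)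
  exact hfin.congr fun _ => rfl

/-- **Phase words on codes**: `((p, i, s, x), c) ↦ p.phaseWordC i s x c`. [folklore] -/
theorem phaseWordC_fp : CodeFP (pairE lcE outBE) (rawE agE0) (fun t => t.1.1.phaseWordC t.1.2.1 t.1.2.2.1 t.1.2.2.2 t.2) := by
  have hP : CodeFP (pairE lcE outBE) bpE (fun t => t.1.1) := (fst _ _).fst'
  have hws : CodeFP (pairE lcE outBE) (rawE natE) (fun t => t.1.1.cr :: t.1.1.as) := ((rawCons natE).comp ((cr_n.comp hP).pair (as_fp.comp hP)) :)
  have hops : CodeFP (pairE lcE outBE) (rawE clopE) (fun t => t.1.1.gopsA (t.1.1.insPhaseA t.1.2.1 t.1.2.2.1 t.1.2.2.2) t.2) :=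
    (gopsA_fp.comp (hP.pair ((insPhaseA_fp.comp (fst _ _)).pair (snd _ _))) :)
  have hsw : CodeFP (pairE lcE outBE) (rawE agE0) (fun t => phaseSandwichA (t.1.1.cr :: t.1.1.as)
      (t.1.1.gopsA (t.1.1.insPhaseA t.1.2.1 t.1.2.2.1 t.1.2.2.2) t.2) [t.1.1.cr] [t.1.1.gflagA t.2]) :=
    (phaseSandwichA_fp.comp (hws.pair (hops.pair (((rawSingleton natE).comp (cr_n.comp hP)).pair ((rawSingleton natE).comp (gflagA_fp hP (snd _ _)))))) :)
  have hfin : CodeFP (pairE lcE outBE) (rawE agE0) (fun t => oaaWordA (phaseSandwichA (t.1.1.cr :: t.1.1.as)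
      (t.1.1.gopsA (t.1.1.insPhaseA t.1.2.1 t.1.2.2.1 t.1.2.2.2) t.2) [t.1.1.cr] [t.1.1.gflagA t.2]) t.1.1.GRA) := (oaaWordA_fp.comp (hsw.pair (GRA_fp.comp hP)) :)
  exact hfin.congr fun _ => rfl

/-- The compiled rotation programs on codes. [folklore] -/
theorem progR_fp (z sgn : ℤ) : CodeFP bpE outBE (fun p => p.progR z sgn) :=
  ((compile_inst_codeFP (bRotPB z sgn)).comp fields_u.2.2.1).congr fun p => by show _ = (bRot p.k z sgn).compile p.Wd 0 0; rw [← inst_bRotPB]; rfl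

/-- The compiled phase programs on codes (the sign is data). [folklore] -/
theorem progP_fp : CodeFP (pairE bpE bitE) outBE (fun t => t.1.progP t.2) := by
  have h : ∀ pos : Bool, CodeFP (pairE bpE bitE) outBE (fun t => t.1.progP pos) := fun pos =>
    ((compile_inst_codeFP (bPhasePB pos)).comp (fields_u.2.2.1.comp (fst _ _))).congr fun t => by show _ = (bPhase t.1.k pos).compile t.1.Wd 0 0; rw [← inst_bPhasePB]; rfl
  exact ((snd _ _).ite (h true) (h false)).congr fun t => by obtain ⟨p, b⟩ := t; cases b <;> rfl

/-- **Rotation words `(z, sgn)` on codes.** [folklore] -/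
theorem rotWordA_fp (z sgn : ℤ) : CodeFP lcE (rawE agE0) (fun t => t.1.rotWordA t.2.1 t.2.2.1 t.2.2.2 z sgn) := by
  have hc : CodeFP lcE outBE (fun t => t.1.progR z sgn) := ((progR_fp z sgn).comp (fst _ _) :)
  have h : CodeFP lcE (rawE agE0) (fun t => t.1.rotWordC t.2.1 t.2.2.1 t.2.2.2 (t.1.progR z sgn)) := (rotWordC_fp.comp ((CodeFP.id _).pair hc) :)
  exact h.congr fun _ => rfl

/-- **Phase words `±` on codes**: `((p, i, s, x), σ) ↦ p.phaseWordA i s x σ`. [folklore] -/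
theorem phaseWordA_fp : CodeFP (pairE lcE bitE) (rawE agE0) (fun t => t.1.1.phaseWordA t.1.2.1 t.1.2.2.1 t.1.2.2.2 t.2) := by
  have hc : CodeFP (pairE lcE bitE) outBE (fun t => t.1.1.progP t.2) := (progP_fp.comp ((fst _ _).fst'.pair (snd _ _)) :)
  have h : CodeFP (pairE lcE bitE) (rawE agE0) (fun t => t.1.1.phaseWordC t.1.2.1 t.1.2.2.1 t.1.2.2.2 (t.1.1.progP t.2)) := (phaseWordC_fp.comp ((fst _ _).pair hc) :)
  exact h.congr fun _ => rfl

/-- The code of the contexts `(p, s, i, σ)` of letters. [folklore] -/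
abbrev leE : BP × ℕ × ℕ × Bool → List Bool := pairE bpE (pairE natE (pairE natE bitE))

/-- **Letters on codes**: `(p, s, i, σ) ↦ p.letterA s i σ`. [cite: AharonovJonesLandau2009, Claim 4.1] -/
theorem letterA_fp : CodeFP leE (rawE agE0) (fun t => t.1.letterA t.2.1 t.2.2.1 t.2.2.2) := by
  -- the letter context `(p, i, s, x)` with `x = 2 i + σ`
  have hx : CodeFP leE natE (fun t => 2 * t.2.2.1 + t.2.2.2.toNat) :=
    (natAdd.comp ((natMul.comp ((const _ 2).pair (snd _ _).snd'.fst')).pair (BravyiGosset.toNat_codeFP.comp (snd _ _).snd'.snd')) :)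
  have hlc : CodeFP leE lcE (fun t => (t.1, t.2.2.1, t.2.1, 2 * t.2.2.1 + t.2.2.2.toNat)) := ((fst _ _).pair ((snd _ _).snd'.fst'.pair ((snd _ _).fst'.pair hx)) :)
  have hσ : CodeFP leE bitE (fun t => t.2.2.2) := (snd _ _).snd'.snd'
  have hR : ∀ z sgn : ℤ, CodeFP leE (rawE agE0) (fun t => t.1.rotWordA t.2.2.1 t.2.1 (2 * t.2.2.1 + t.2.2.2.toNat) z sgn) := fun z sgn => ((rotWordA_fp z sgn).comp hlc :)
  have hPh : CodeFP leE (rawE agE0) (fun t => t.1.phaseWordA t.2.2.1 t.2.1 (2 * t.2.2.1 + t.2.2.2.toNat) t.2.2.2) := (phaseWordA_fp.comp (hlc.pair hσ) :)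
  have h : CodeFP leE (rawE agE0) (fun t => t.1.rotWordA t.2.2.1 t.2.1 (2 * t.2.2.1 + t.2.2.2.toNat) 2 (-1) ++ t.1.rotWordA t.2.2.1 t.2.1 (2 * t.2.2.1 + t.2.2.2.toNat) 3 (-1) ++
      t.1.phaseWordA t.2.2.1 t.2.1 (2 * t.2.2.1 + t.2.2.2.toNat) t.2.2.2 ++ t.1.rotWordA t.2.2.1 t.2.1 (2 * t.2.2.1 + t.2.2.2.toNat) 3 1 ++
      t.1.rotWordA t.2.2.1 t.2.1 (2 * t.2.2.1 + t.2.2.2.toNat) 2 1) := agAppend (agAppend (agAppend (agAppend (hR 2 (-1)) (hR 3 (-1))) hPh) (hR 3 1)) (hR 2 1)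
  exact h.congr fun _ => rfl

/-- The letters `(i, ±)` on codes. [folklore] -/
theorem lettersA_fp : CodeFP bpE (rawE (pairE natE bitE)) (fun p => lettersA p.n) := by
  have h1 : CodeFP bpE unE (fun p => p.n - 1) := (unOfNatMin.comp (fields_u.1.pair (natSub.comp ((toNat fields_u.1).pair (const _ 1))))).congr fun p => by
    show min (p.n - 1) p.n = p.n - 1; omega
  have hitem : CodeFP (pairE bpE natE) (rawE (pairE natE bitE)) (fun t => [(t.2, false), (t.2, true)]) :=
    ((rawCons _).comp (((snd _ _).pair (const _ false)).pair ((rawSingleton _).comp ((snd _ _).pair (const _ true)))) :)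
  have h : CodeFP bpE (rawE (pairE natE bitE)) (fun p => ((List.range (p.n - 1)).map fun i => [(i, false), (i, true)]).flatten) :=
    ((flatten _).comp ((map hitem).comp ((CodeFP.id _).pair (urange.comp h1))) :)
  exact h.congr fun _ => rfl

/-- **Slots on codes**: `(p, s) ↦ p.slotA s`. [cite: AharonovJonesLandau2009, §3.2] -/
theorem slotA_fp : CodeFP (pairE bpE natE) (rawE agE0) (fun t => t.1.slotA t.2) := by
  have hitem : CodeFP (pairE (pairE bpE natE) (pairE natE bitE)) (rawE agE0) (fun q => q.1.1.letterA q.1.2 q.2.1 q.2.2) :=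
    (letterA_fp.comp ((fst _ _).fst'.pair ((fst _ _).snd'.pair (snd _ _))) :)
  have hrev : CodeFP (pairE bpE natE) (rawE (pairE natE bitE)) (fun t => (lettersA t.1.n).reverse) := ((rawReverse _).comp (lettersA_fp.comp (fst _ _)) :)
  have h : CodeFP (pairE bpE natE) (rawE agE0) (fun t => ((lettersA t.1.n).reverse.map fun ib => t.1.letterA t.2 ib.1 ib.2).flatten) :=
    ((flatten agE0).comp ((map hitem).comp ((CodeFP.id _).pair hrev)) :)
  exact h.congr fun _ => rfl

/-- **The word on codes.** [cite: AharonovJonesLandau2009, §3.2] -/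
theorem wordA_fp : CodeFP bpE (rawE agE0) BP.wordA := by
  have hrev : CodeFP bpE (rawE natE) (fun p => (List.range p.r).reverse) := ((rawReverse natE).comp (urange.comp fields_u.2.1) :)
  have h : CodeFP bpE (rawE agE0) (fun p => ((List.range p.r).reverse.map fun s => p.slotA s).flatten) := ((flatten agE0).comp ((map slotA_fp).comp ((CodeFP.id _).pair hrev)) :)
  exact h.congr fun _ => rfl

/-- **The copy on codes**: `(p, im) ↦ p.copyA im`. [cite: AharonovJonesLandau2009, §3.3] -/
theorem copyA_fp : CodeFP (pairE bpE bitE) (rawE agE0) (fun t => t.1.copyA t.2) := by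
  have h : CodeFP (pairE bpE bitE) (rawE agE0) (fun t => hadTestA t.1.q t.1.wordA t.2) := (hadTestA_fp.comp ((q_n.comp (fst _ _)).pair ((wordA_fp.comp (fst _ _)).pair (snd _ _))) :)
  exact h.congr fun _ => rfl

end BP

end AJLCore

end Literature.Computability.QuantumComplexity

end
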